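import Mathlib
import HarnessLib
import HarnessLib.Audit
import Summits.AtomisticToContinuum.Statement
import Literature.Analysis.FluidPDE.HardSphereFlowConstruction
import HarnessLib.Audit.Status.Attr

/-!
Route: LambertianContactSwap

DORMANT since 2026-08-24T12:37:25Z (reconciler: no traction for 6.8 d (last activity item-evidence-added at 2026-08-17T17:27:11Z); parked, not closed — `ledger route dormant route-AtomisticToContinuum-LambertianContactSwap --off` to rea) — unstaffed, not closed; items shared with open routes are served there. `ledger route dormant <id> --off` reactivates.

# Route LambertianContactSwap — swap specular for Lambertian contact by contact — Euler for
deterministic spheres from the Lambertian gas plus an exact hybrid identity, with a conforming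
deciding theorem

X = SwapGap ∧ LambertianEuler ("it suffices to show"), realising card specular-lambertian-swap
(spine). This is the CONFORMING successor
(D-0027 §2.1) of the retired route SpecularLambertianSwap: same comparison node and random-model
theorem, a typed Portmanteau transfer and a
typed probability-measure lemma as supports, and (rev 4) the deciding theorem `closes : SwapGap →
LambertianEuler → HydrodynamicLimit` whose Markov/Portmanteau transfer is PROVED
inside `closes` itself (certified native, sorry-free; no support or assembly item is a hypothesis);
the retired route's universal-test-function equidistribution crux is REPLACED by
the restricted form the mechanism actually consumes (the universal form is false at fixed σ, see Why
this line). The LAMBERTIAN GAS Λ: the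
library's collision-by-collision hard-sphere dynamics (`Alexander.freeExitTime` / `incomingPairs`:
same free flight, same contacts, same partners
as the deterministic flow) in which at the k-th contact the outgoing relative velocity is |g|·n_k,
n_k = normalize(ω̂ + ξ̂_k), ξ_k i.i.d.
standard Gaussian — the cosine (Lambert) law on the outgoing hemisphere about the contact normal ω;
pair momentum and kinetic energy are
conserved exactly, Liouville and every hard-sphere Gibbs law are Λ-invariant, and the equation of
state is the same p = ρθZ(ρσ³) (flux-averaged
momentum transfer: specular ε·(2/3)|g| = Lambertian (ε/2)((2/3)|g| + (2/3)|g|)). SwapGap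
(DERANDOMISATION): from the same local Gibbs data,
pre-shock, the laws of the χ-tested empirical density/momentum/energy fields under the deterministic
flow Φ_t and under Λ_t merge
(bounded-Lipschitz test functions). LambertianEuler: the fields of Λ_t converge in probability to
the classical hs-Euler solution (OVY/FFL/LO
class random-model theorem). Card lindeberg-random-future-universality is the ALTERNATIVE layer-2
allocation of the same SwapGap (kinetic
screening + slab closure in mean) and is not realised here.
Lean: `SwapGap ∧ LambertianEuler`

## Assembly
PROVED glue (rev 4): `closes (hS : SwapGap) (hL : LambertianEuler) : _root_.HydrodynamicLimit`,
axioms propext/Classical.choice/Quot.sound.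
σ₀ := min σ_S σ_L; for each of density/momentum/energy and δ > 0 the 1-Lipschitz cutoff g = min 1
(max (· − δ/2) 0) of the deviation gives
min(1,δ/2)·P_N{δ < dev(Φ_t z)} ≤ ∫ g∘dev∘Φ_t dP_N (Markov; P_N = localGibbsLaw is a FINITE measure
for every σ and N — either 1_D·f₀^⊗(N+1)
is integrable or the canonical partition function is the Bochner junk value 0 and the law is the
zero measure — and the deviation is
measurable: the empirical fields are finite averages of continuous functions, Φ_t is measurable) = ∫
g∘dev∘Λ_t d(P_N⊗γ^ℕ) + o(1) (SwapGap with
the 1-Lipschitz test function g∘|proj − c|) ≤ (P_N⊗γ^ℕ){δ/2 < dev(Λ_t)} + o(1) (measurability-free: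
ofReal ∫ ≤ ∫⁻ ofReal ≤ measure of the set)
→ 0 (LambertianEuler at δ/2). The items Assembly (= SwapGap → LambertianEuler → HydrodynamicLimit,
now literally the content of `closes`),
MergingTransfer and LocalGibbsProbability are no longer load-bearing for the decision;
ContactAngleEquidistribution, SwapIdentity,
LambertianWellPosed and CollisionMomentBound are NOT hypotheses of the decision: they enter only the
layer-2 proof of SwapGap (Two-layer plan).

Rationale: WHY THIS LINE. The hybrid (Lindeberg–Trotter) argument run over the COLLISION SEQUENCE of the
deterministic trajectory: switching from specular to Lambertian
after the m-th collision and telescoping gives an exact identity (support SwapIdentity, typed) whose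
m-th term is the angular fluctuation of the
RANDOM-future value function at the m-th deterministic contact — the consistency–stability identity
of Kac's program (MischlerMouhot2012;
for hydrodynamic limits of stochastic lattice gases arXiv:2212.00079, arXiv:2412.16714) run between
two N-BODY gases rather than N-body vs.
limit, i.e. Lindeberg swapping (Chatterjee2006). Two smallnesses meet at each contact and multiply:
forward conservative noise makes the value
function Lipschitz in one collision's outgoing angle with a DETERMINISTIC leading coefficient
N^(-4/3)L_s(x) (law-level linear response of a
Markov gas, OllaVaradhanYau1993 / FritzFunakiLebowitz1994 / LiveraniOlla1996 technology; random
cosine-law reflections CometsEtAl2008,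
FeresYablonsky2004), so the deterministic gas is asked only for equidistribution of the contact
normal GIVEN THE PAIR'S VELOCITIES AND POSITION
(crux ContactAngleEquidistribution: exact in equilibrium since positions ⊥ velocities; standard-pair
/ one-curve hyperbolicity out of
equilibrium, ChernovDolgopyat2009, CanestrariLiveraniOlla2026) — NOT given the full environment:
conditional on the other spheres the normal
law is the cosine law restricted to geometrically allowed normals, an O(1) defect for the ≍10σ³
fraction of collisions with a third sphere
within 2ε, so the retired route's universal-ψ crux is false at every fixed σ (test function =
normalised penetration depth); that O(σ³) effect
is zonal about ĝ and renormalises the Volterra kernel (c_L = 1/16 plus an O(σ³) shift) instead of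
forcing. The criticality rate × influence =
O(1) is closed by a linear Volterra–Gronwall through the collision statistics of the deterministic
gas, never term by term. Imported areas:
probability (Lindeberg universality, Kantorovich–Rubinstein duality, Portmanteau), smooth ergodic
theory (standard pairs), stochastic
interacting particle systems (OVY with conservative noise). What no open route does:
UGibbsSRBRigidity/PesinPricing classify stationary or
u-regular states of the deterministic dynamics, HeatBathForgetting/OneFlightGossipEngine build
endogenous noise inside Yau's method,
VanishingNoise (blocked) removes a vanishing noise; here ALL infinite-time ergodic theory lives in a
fixed, fully random comparison gas and the
deterministic system contributes only finite-time, two-body, local statistics. Negatives index (6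
entries, 3 on this sub-problem:
EnskogAdjointDuality test family, WarmColdDichotomy ColdIsRare/ColdCellsNegligible): every item here
keeps the conjunct's own quantifier prefix
(Euler data tied to the local Gibbs data through the t = 0 hypothesis), so the 'arbitrary classical
Euler solution on the junk EOS branch'
witness of stmt-9168 does not apply.

RANKED CRUXES. #2 SwapGap (crux) — DERANDOMISATION GAP (card A1∧A2∧A4 + Volterra–Gronwall, layer-1
form; verbatim the comparison node of the retired routes
SpecularLambertianSwap/RandomFutureLindeberg). For continuous profiles a₀, θ₀ > 0, u₀ there is σ₀ >
0 such that for 0 < σ < σ₀, every classical hs-Euler solution on [0,T), every family of hard-sphere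
flows Φ_N and local Gibbs data whose fields converge at t = 0: for every t < T, continuous χ and
every 1-Lipschitz F : ℝ × ℝ³ × ℝ → [−1,1] of the three χ-tested empirical fields, E_(P_N)
F(fields(Φ_N,t z)) − E_(P_N ⊗ γ^ℕ) F(fields(Λ_N,t(z, ξ))) → 0, where Λ = lflow is the Lambertian
flow written as an inline `let` block shared verbatim by the items (Cfg, G, ε = hsDiameter, τ =
Alexander.freeExitTime, S = free flight, ldir ω ξ = normalize(ω̂+ξ̂), lpair =
momentum/energy-conserving redraw of the pair along ldir, lstep = collisionStep with collidePair
replaced by the redraw, lstate/linst/lflow = its ξ-driven iteration, instants and right-continuous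
flow exactly as Alexander.stateAfter/collisionInstant/fwdFlow, noise = infinitePi of standard
Gaussians, fld = the field triple, P N = localGibbsLaw). [difficulty: open-problem] (why it might
fail: rate × influence is critical (σ²N^(4/3) contacts × N^(-4/3) influence): if Λ's response to one
redirected pair is not O(N^(-4/3))-Lipschitz uniformly over deterministically evolved states, or the
colliding-pair-statistics class (c_L = 1/16 channel) does not close, the gap stays O(σ²).)
[MischlerMouhot2012, Chatterjee2006, arXiv:2212.00079, OllaVaradhanYau1993, doi:10.3934/krm.2018008,
Fougeres2024]
#3 LambertianEuler (crux) — EULER FOR THE LAMBERTIAN GAS (card A3 = angular-noise-ladder's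
random-model target at p = 0 = lindeberg-random-future-universality crux 3; verbatim the retired
routes' item). Same quantifiers as the conjunct; conclusion: under P_N ⊗ γ^ℕ the χ-tested empirical
density, momentum and energy fields of Λ_N,t converge in probability to ∫χρ_t, ∫χρ_t u_t, ∫χE_t for
every t < T. Expected proof: OVY relative entropy method with the conservative angular collision
noise supplying the ergodic decomposition (stationary translation-invariant finite-entropy states of
the infinite Lambertian gas are mixtures of Gibbs), same EOS (Gibbs laws are Λ-invariant).
[difficulty: open-problem] (why it might fail: true kinetic energy |v|²/2 (HighMomentumCutoff: OVY
need bounded ∇(kinetic energy) for the cubic energy-current LD bounds), and the ergodic theorem must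
come from noise acting ONLY on collision angles with deterministic partner selection (degenerate;
cf. card angles-are-not-enough Prop A).) [OllaVaradhanYau1993, FritzFunakiLebowitz1994,
LiveraniOlla1996, CometsEtAl2008, Rezakhanlou2003]
#4 ContactAngleEquidistribution (crux) — CONTACT-NORMAL EQUIDISTRIBUTION GIVEN THE PAIR (card A1 in
the restricted form the swap consumes; replaces the retired universal-ψ crux, which is false). For
profiles, 0 < σ < σ₀, flows Φ, any t ≥ 0 and any test functions ψ_N(s, x, v, v*, n) — measurable,
|ψ| ≤ 1, 1-Lipschitz in the unit normal n, depending on the collision ONLY through its instant s,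
midpoint x, incoming velocities v, v* and normal — the normalised |g|²-weighted collision sum
(N+1)^(-4/3) · E_(P_N) Σ_(collisions k ≤ t) |g_k|² [ψ_N(t_k, x_k, v_i, v_j, ω_k) − ∫ ψ_N(t_k, x_k,
v_i, v_j, n) κ_(g_k)(dn)] → 0, where ω_k = ε⁻¹·sepVec(x_i, x_j) is the contact normal of the k-th
collision of the library's deterministic construction (lets zpre/tcol/Kt/hit over
Alexander.stateAfter/collisionInstant/collisionCount, contactSet, IsIncoming) and κ_g ∝ (n·ĝ)₋ dn is
the kinematic cosine law (sampled as normalize(−ĝ+ξ̂), ξ Gaussian). In words: given where, when and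
with which velocities a collision happens, its impact geometry has no low-frequency bias, in
|g|²-weighted collision average — exact in equilibrium (positions ⊥ velocities, isotropic contact
pair correlation), never a statement conditional on the other spheres. [deps: CollisionMomentBound]
[difficulty: XL] (why it might fail: exact in equilibrium; out of it, ring/recollision events
(frequency O(σ³) at fixed density) correlate (g, ω) in proportion to local velocity gradients
(Lutsko1996): the bet is this defect is O(φ·Kn) → 0; an O(φ) contact-anisotropy bias surviving N → ∞
kills it.) [Lutsko1996, ChernovDolgopyat2009, CanestrariLiveraniOlla2026, CIP1994, GST2013]
#9 LocalGibbsProbability (support) — LOCAL GIBBS LAWS ARE PROBABILITY MEASURES at small reduced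
density (provable now; σ₀ = 1/2 works): for 0 < σ < σ₀, continuous a₀, θ₀ > 0, u₀ and every N,
localGibbsLaw σ a₀ u₀ θ₀ N Φ = (liouville).withDensity(canonicalDensity) has total mass 1 — the
canonical partition function is finite (Maxwellian tails, a₀ bounded on the compact torus) and
POSITIVE because (N+1) spheres of diameter σ(N+1)^(-1/3) < (1/2)(N+1)^(-1/3) ≤ 1/⌈(N+1)^(1/3)⌉ fit
on a cubic sub-lattice of 𝕋³ with an open neighbourhood to spare. Needed by the Markov step of
MergingTransfer; cf. CramerEdgeLadder.EquilibriumIsProbability (homogeneous profiles). [difficulty: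
provable-now] [Ruelle1969, GST2013, Spohn1991]
#9 MergingTransfer (support) — PORTMANTEAU TRANSFER (the typed glue of the deciding theorem;
provable now). If the local Gibbs laws are probability measures for small σ, the field laws of Φ_t
and Λ_t merge (SwapGap) and Λ's fields converge in probability to the Euler values
(LambertianEuler), then the conjunct holds: fix profiles, σ₀ := min of the three thresholds; for σ <
σ₀, data, flows, the t = 0 hypothesis (passed verbatim to both cruxes), t < T, χ, δ: with the
1-Lipschitz [0,1]-valued F(d,m,e) := min(1, (|d − ∫χρ_t| − δ/2)₊) one has min(1,δ/2)·P_N(δ <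
|density field(Φ_t z) − ∫χρ_t|) ≤ ∫F∘fields∘Φ_t dP_N (Markov: bounded measurable integrand, P_N
finite) = ∫F∘fields∘Λ_t d(P_N⊗γ^ℕ) + o(1) (SwapGap) ≤ (P_N⊗γ^ℕ)(δ/2 < |density field(Λ_t) − ∫χρ_t|)
+ o(1) (F ≤ indicator; if the Λ-integrand is not a.e.-measurable its Bochner integral is 0 and the
bound is trivial) → 0 (LambertianEuler at δ/2); likewise momentum (F of ‖m − ∫χρ_t u_t‖) and energy.
The `let` blocks of SwapGap/LambertianEuler are syntactically identical, so the Λ-terms match after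
zeta-reduction. [deps: LocalGibbsProbability, SwapGap, LambertianEuler] [difficulty: provable-now]
[OllaVaradhanYau1993, Billingsley1999, Dudley2002]
#9 SwapIdentity (support) — THE EXACT HYBRID (TROTTER–LINDEBERG) IDENTITY (card A4(b); verbatim the
retired item). For 0 < σ < 1/2, N, t ≥ 0, bounded measurable F, z in the good set Γ₀ of the
library's construction and almost surely non-accumulating Lambertian continuations (hypotheses):
F(Φ_t z) − E_γ F(Λ_t(z,·)) = Σ_(m < K_t(z)) [ (P⁰_(t−t_(m+1)) F)(collisionStep z_m) − ∫
(P⁰_(t−t_(m+1)) F)(lstep_ξ z_m) γ(dξ) ], with P⁰_u F(y) := E_γ F(Λ_u(y,·)) and z_m = stateAfter z m: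
telescoping H_m := P⁰_(t−t_m)F(z_m) over the deterministic collision sequence (H_K = F(Φ_t z) since
both gases share free flight and exit times; H_0 = P⁰_t F(z)), the restart property lstate (ξ_0, ξ')
y (k+1) = lstate ξ' (lstep ξ_0 y) k and Fubini for γ^ℕ ≅ γ ⊗ γ^ℕ (Measure.infinitePi). N + 1 = 2 is
the unit test. [deps: LambertianWellPosed] [difficulty: provable-now] [MischlerMouhot2012,
Chatterjee2006, CIP1994]
#9 LambertianWellPosed (support) — ALEXANDER'S THEOREM FOR THE LAMBERTIAN FLOW (verbatim the retired
item): for 0 < σ < 1/2 and every N, (a) (z, ξ) ↦ Λ_t(z, ξ) is jointly measurable for each t (the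
choice `Set.Nonempty.some` factors through the finitely-valued measurable map z ↦ incomingPairs, so
it does not obstruct measurability); (b) for Liouville ⊗ γ^ℕ-a.e. (z, ξ) every finite exit
configuration of the ξ-driven recursion is a simple incoming collision, no pair touches strictly
inside a free flight, and the exit times sum to ∞ (the three FwdGood clauses for lstate). Same
flux/measure-preservation argument as torusFlow_ae_good_holds / torusFlow_measurable_holds: the
cosine redraw maps the incoming flux measure |g·ω|dS onto the outgoing one, so Liouville is
Λ-invariant (one-particle random billiards: CometsEtAl2008, FeresYablonsky2004). [difficulty: M]
[GST2013, CIP1994, CometsEtAl2008, FeresYablonsky2004, Alexander1975]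
#9 CollisionMomentBound (support) — A-PRIORI COLLISION FLUX MOMENTS (card A5; verbatim the retired
item; module shared with card apriori-tails-and-rattlers): for profiles, 0 < σ < σ₀, t ≥ 0 there is
C with E_(P_N)[(N+1)^(-4/3) Σ_(collisions k ≤ t) (1 + |g_k|³)] ≤ C for all N (normalised
|g|³-weighted collision count of the deterministic flow under local Gibbs data; expected size
O(σ²)). Makes the sums in ContactAngleEquidistribution and in SwapIdentity's use O(1) and
non-vacuous. CAVEAT recorded for provers: the entropy-inequality route (relative entropy O(N) w.r.t.
the invariant Gibbs law + exponential moments under equilibrium) FAILS for the cubic weight — a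
sphere of speed V contributes ≍ σ²tV⁴ to N^(-1/3)Σ|g|³ against the Gaussian weight e^(−V²/2θ) — so a
first-moment argument through the flux (contact) measure of the time-evolved law is needed; this is
the HighMomentumCutoff instance of the line. [difficulty: L] [Spohn1991, KipnisLandim1999, CIP1994,
GST2013]

TWO-LAYER PLAN. SwapGap ⇐ ContactAngleEquidistribution → LambertianLinearResponse → SwapGap, glue =
SwapIdentity + CollisionMomentBound + a linear
Volterra–Gronwall inequality for the vector (field gaps, colliding-pair statistics gaps).
LambertianLinearResponse (card A2; filed INFORMAL at
open, rank 5, typed once the Lambertian API is a named definition): for P_N-typical pre-collisional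
z and smooth F of tested fields,
n ↦ (P⁰_(t−s)F)(lpair n z) is Lipschitz with constant ≤ C|g|²N^(-4/3)(‖F′‖‖∇χ‖+…), its first-order
part is −ℓ_s(z):(g′⊗g′)° + cubic with
ℓ_s(z) = N^(-4/3)L_s(x) + o(N^(-4/3)) for a DETERMINISTIC tensor field L_s (linearised hs-Euler
propagator applied to a relaxing stress dipole)
— this determinism is exactly what reduces the needed equidistribution to test functions of (s, x,
v_i, v_j, ω) — and the same with F
replaced by the colliding-pair statistics that appear at first order (class closure).
LambertianEuler ⇐ MacroErgodicityΛ → OVYBookkeepingΛ →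
LambertianEuler (angular-noise-ladder cruxes 1–2 at p = 0). The ALTERNATIVE split of SwapGap by
kinetic screening [S] + slab closure in mean
[I] (card lindeberg-random-future-universality) is a separate route sharing SwapGap/LambertianEuler
by signature.

KILL CRITERIA. ¬SwapGap (e.g. event-driven MD: HS(1) vs HS(0) block-field gap from identical local
Gibbs samples NOT decaying like N^(-1/3), or a proof that
the deterministic flux-weighted colliding-pair statistics stay O(1) away from the Lambertian ones)
closes the route `refuted:SwapGap` and refutes
card lindeberg-random-future-universality with it. ¬LambertianEuler (a non-Gibbs
translation-invariant finite-entropy stationary state of the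
Lambertian gas; angles-are-not-enough Prop A made dynamical) forces a pivot of the comparison gas to
Rezakhanlou's partner-randomised
stochastic Enskog process (card variant; SwapGap restated, c_L = 0). ¬ContactAngleEquidistribution
(an O(φ) contact-anisotropy bias given
the pair's velocities surviving N → ∞) kills the card's layer-2 allocation only: pivot SwapGap's
split to [S]+[I]. ¬MergingTransfer or
¬LocalGibbsProbability cannot happen without an error in the typed statements (then restate).
HydrodynamicLimit proved by any entropy route
moots SwapGap but leaves LambertianEuler / ContactAngleEquidistribution as independently wanted
statements.

NOT DECOMPOSED YET. LambertianLinearResponse (A2, informal at open) and the Volterra–Gronwall glue —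
they need the Lambertian API as named definitions and the
stress-response field L_s; the closure class is probably infinite-dimensional (the flux-weighted
colliding-pair velocity law tested against
smooth Gaussian-weighted functions, cf. card angles-are-not-enough SEL), to be organised as a
Gronwall in a weighted bounded-Lipschitz norm,
not 'finitely many unknowns'. The extension of ContactAngleEquidistribution to test functions
depending on the environment MACROSCOPICALLY
(insensitive to single-sphere moves at scale ε) — the honest intermediate between the restricted
(true, filed) and universal (false) forms.
The O(σ³) zonal renormalisation of the Volterra kernel by blocked normals. Grazing / short backward
flights inside the equidistribution proof
(must sit in constants, not in the forcing). Velocity-tail truncations inside LambertianEuler. The N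
+ 1 = 2 unit test of SwapIdentity;
smooth-vs-continuous χ and bounded-Lipschitz-vs-smooth F approximations (layer-2 support, provable
now).

CHEAPEST FALSIFIER. (i) Analytic, done (previous seat, re-derived here): with ω kinematically
distributed, specular outgoing directions are isotropic
(E ĝ′ĝ′ᵀ = I/3) while Lambertian ones give E nnᵀ = (5/16)I + (1/16)ĝĝᵀ, so c_L = 1/16 ≠ 0 — the
anisotropy channel is real and the Volterra
closure is genuinely needed (consistent with the card; not a kill); flux-averaged momentum transfer
is identical (2/3·ε|g|), so the EOS is
shared. (ii) Done here, a KILL of the retired form: ψ = normalised penetration depth refutes the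
universal-ψ equidistribution at every fixed σ
(blocked normals, frequency ≍ 10σ³) — hence the restricted crux. (iii) Provable-now unit test:
SwapIdentity for N + 1 = 2 on 𝕋³.
(iv) The decisive cheap experiment (kit, when available): event-driven MD, φ = 0.05–0.2, N =
10³–10⁵, HS(1) and HS(0) from identical
local-Gibbs samples (sinusoidal shear + temperature wave): low-Fourier-mode momentum/energy gap vs N
must decay like Kn = N^(-1/3); histogram
of ω relative to ĝ over real collisions, binned by (x, v, v*) coarsely and tested against the 5
lowest zonal AND tesseral harmonics, must show
no O(1) bias (Lutsko1996 measured the shear-rate-proportional bias; prediction here: ∝ φ·Kn).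

NUMBERS. Fixed reduced density: (N+1)ε³ = σ³; mean free path ℓ ≍ N^(-1/3)/σ² (Kn ≍ N^(-1/3));
collisions per particle per unit time ≍ σ²N^(1/3), in
total ≍ σ²N^(4/3) on [0,t]; instantaneous change of conserved χ-fields by one redirected pair
O(ε|g|‖∇χ‖/N), time-integrated flux
perturbation O(|g|²N^(-4/3)) ⇒ rate × influence = O(1) (critical; closed by Gronwall, not term by
term). c_L = 1/16. Fraction of collisions
with a third sphere within 2ε of the midpoint ≍ (32π/3)σ³ ≈ 33σ³ (blocked-normal defect, zonal).
Cosine law: E[n·ω] = 2/3 = flux-averaged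
⟨|ĝ·ω|⟩. OVY 1993 Thm 1.1: Euler with noise for bounded-velocity Hamiltonians (the class
LambertianEuler must leave). Items at open: 9
(+1 informal crux after open).

DEFINITION REQUESTS. LambertianHardSphereFlow API as named definitions (new object posited for this
problem; topic Summits/AtomisticToContinuum/HydrodynamicLimit/
Theorems): `lambertDir ω ξ`, `lambertPair i j z ξ`, `lambertStep`, `lambertStateAfter`,
`lambertInstant`, `lambertCount`, `lambertFlow`,
`lambertNoise` — verbatim the `let` block of SwapGap — so that
SwapGap/LambertianEuler/SwapIdentity/LambertianWellPosed can be restated with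
short signatures and LambertianLinearResponse typed. Filed with `ledger workitem add --kind
definition --for <LambertianLinearResponse>` after
open. No cite facts needed: Alexander's theorem on 𝕋³ is PROVED in the tree (torusFlow_*_holds); no
unproved Literature fact is imported by
any item.

Novelty: Searches (2026-08-15, this seat; local searchd and galaxy back-ends were unavailable/empty (rc 75 /
0 rows on 3 phrasings), remote cascade used):
`lit search --source crossref "Lindeberg replacement interacting particle systems hydrodynamic
limit"` (8: Menegaki–Mouhot 2022
doi:10.5802/slsedp.154 = arXiv:2212.00079, consistency–stability for hydrodynamic limits of
stochastic LATTICE gases — nearest architecture;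
rest Kipnis–Landim chapters); `lit search --source arxiv "Menegaki Mouhot quantitative hydrodynamic
limit … consistency stability"` (2:
arXiv:2212.00079, arXiv:2412.16714 zero-range); `lit search --source crossref "stochastic hard
sphere model random scattering direction …
Enskog kinetic limit"` (8: Rezakhanlou2003, Lampis–Petrina 1997, Petrina–Gerasimenko 'stochastic
dynamics as the limit of Hamiltonian
dynamics of hard spheres' doi:10.1515/9783110213201.44 — BG limit; no fixed-density comparison);
`lit search --source crossref "random
billiards Knudsen cosine law reflection invariant measure many particles"` (6: FeresYablonsky2004,
Comets–Popov 2012, Chumley–Feres–Garcia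
2021 — ONE particle, random WALL reflections); `lit search --source arxiv "Lindeberg swapping method
dynamical system random versus
deterministic collisions"` (0); `lit frontier AtomisticToContinuum --since 2023` (30 rows; relevant:
CanestrariLiveraniOlla2026 heat equation
from a deterministic dynamics by standard pairs; JSP 2026 'Fluctuations and moderate deviations for
a binary collision model'); p  [refs: 10.5802/slsedp.154, 10.1515/9783110213201.44, 10.3934/krm.2018008, 2212.00079, 2412.16714, doi:10.5802/slsedp.154, doi:10.1515/9783110213201.44, doi:10.3934/krm.2018008, Rezakhanlou2003, FeresYablonsky2004, CanestrariLiveraniOlla2026, Fougeres2024, Lutsko1996, MischlerMouhot2012, ChernovDolgopyat2009]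

Barriers (technique_class: lindeberg-swap semigroup-interpolation standard-pairs): - technique_class: lindeberg-swap semigroup-interpolation standard-pairs
- Literature.Barriers.AtomisticToContinuum.BoltzmannHypothesisBarrier: the classification of
stationary states is consumed ONLY inside LambertianEuler, for the Lambertian gas, whose
conservative collision noise is the barrier's own evasion (i) (FritzFunakiLebowitz1994 /
LiveraniOlla1996 class); for the deterministic gas no invariant-measure statement is used — only a
finite-time two-body contact statistic (ContactAngleEquidistribution, exact in equilibrium). The
ideal-gas witness is respected: without collisions SwapIdentity's right side is 0 = 0, Λ = Φ = free
flight and LambertianEuler fails, correctly.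
- Literature.Barriers.AtomisticToContinuum.BoltzmannHypothesisBarrierNarrow: same slot; met only by
the noisy gas.
- Literature.Barriers.AtomisticToContinuum.MacroErgodicityBarrier: Euler scale, noise present
exactly where ergodicity is invoked; its diffusive clauses are not met.
- Literature.Barriers.AtomisticToContinuum.HighMomentumCutoffBarrier: it does not evade it; the bet
is that for the Lambertian gas (angular averaging built into the dynamics) Povzner-type tail control
with the true kinetic energy is provable — flagged in LambertianEuler's why-line and in
CollisionMomentBound's caveat (|g|³ weights, no exponential moments).
- Literature.Barriers.AtomisticToContinuum.VelocityReversalBarrier: not met — every statement is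
law-level (in probability / in expectation under local Gibbs data); the identi

History (route lifecycle, newest last):
- 2026-08-16T12:09:28Z · rev 3: restated Assembly (stmt-AtomisticToContinuum-12103) — @note_restate.txt (planner-rground-AtomisticToContinuum-Lambertian-3a6e8fe6-0)
- 2026-08-24T12:37:25Z · DORMANT — reconciler: no traction for 6.8 d (last activity item-evidence-added at 2026-08-17T17:27:11Z); parked, not closed — `ledger route dormant route-AtomisticToConti (operator:999:1799660)

sub-problem: HydrodynamicLimit · status: dormant · opened planner-plancard-AtomisticToContinuum-Hydrody-b8438c6b-g2-0 2026-08-15T18:49:40Z · rev 9 · ledger route-AtomisticToContinuum-LambertianContactSwap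
GENERATED by the gate from the ledger (D-0016/17). Provers cite these decls: `theorem foo : Summit.AtomisticToContinuum.HydrodynamicLimit.Theses.LambertianContactSwap.<Decl> := …` in Summits/AtomisticToContinuum/HydrodynamicLimit/Theorems/<Name>.lean.
-/

namespace Summit.AtomisticToContinuum.HydrodynamicLimit.Theses.LambertianContactSwap

open scoped BigOperators Topology Manifold Classical MeasureTheory ProbabilityTheory Matrix InnerProductSpace ComplexConjugate ContinuousMap
open Filter Set Function TopologicalSpace MeasureTheory

attribute [summit_statement] _root_.HydrodynamicLimit

/-- item stmt-AtomisticToContinuum-11850 · crux · rank 2 · open · by planner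
why it might fail: rate × influence is critical (σ²N^(4/3) contacts × N^(-4/3) influence): if Λ's response to one redirected pair is not O(N^(-4/3))-Lipschitz uniformly over deterministically evolved states, or the colliding-pair-statistics class (c_L = 1/16 channel) does not close, the gap stays O(σ²).
sources: MischlerMouhot2012, Chatterjee2006, arXiv:2212.00079, OllaVaradhanYau1993, doi:10.3934/krm.2018008, Fougeres2024
[target] DERANDOMISATION GAP (verbatim the retired routes' shared node
stmt-AtomisticToContinuum-4433): for continuous profiles there is σ₀ > 0 such that for 0 < σ < σ₀,
every classical hs-Euler solution on [0,T), every family of hard-sphere flows and local Gibbs data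
whose fields converge at t = 0: for every t < T, continuous χ and 1-Lipschitz F bounded by 1 of the
three χ-tested empirical fields, E_(P_N) F(fields(Φ_N,t z)) − E_(P_N ⊗ γ^ℕ) F(fields(Λ_N,t(z, ξ))) →
0, Λ the Lambertian flow (inline `let` block over `Alexander.freeExitTime` / `incomingPairs`: free
flight to the exit time, then the incoming pair's outgoing relative velocity |g|·normalize(ω̂ +
ξ̂_k), ξ_k i.i.d. standard Gaussian = cosine law about the contact normal). Here it is the
conclusion of RandomFutureTransfer, not attacked directly. -/
@[route_item "route-AtomisticToContinuum-LambertianContactSwap", crux]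
def SwapGap : Prop :=
  let Cfg : ℕ → Type := fun N => Literature.Analysis.FluidPDE.Config (N + 1) (Fin 3) (UnitAddTorus (Fin 3)); let G := Literature.Analysis.FluidPDE.Torus.geometry (Fin 3); let ε : ℝ → ℕ → ℝ := Literature.MathematicalPhysics.KineticTheory.hsDiameter; let τ : ℝ → (N : ℕ) → Cfg N → ENNReal := fun σ N z => Literature.Analysis.FluidPDE.Alexander.freeExitTime G (ε σ N) z; let S : ℝ → (N : ℕ) → Cfg N → Cfg N := fun t _ z => Literature.Analysis.FluidPDE.freeFlight G t z; let ldir : EuclideanSpace ℝ (Fin 3) → EuclideanSpace ℝ (Fin 3) → EuclideanSpace ℝ (Fin 3) := fun ω ξ => ‖‖ω‖⁻¹ • ω + ‖ξ‖⁻¹ • ξ‖⁻¹ • (‖ω‖⁻¹ • ω + ‖ξ‖⁻¹ • ξ); let lpair : (N : ℕ) → Fin (N + 1) → Fin (N + 1) → Cfg N → EuclideanSpace ℝ (Fin 3) → Cfg N := fun _ i j z ξ => let c := (2 : ℝ)⁻¹ • ((z i).2 + (z j).2); let w := (‖(z i).2 - (z j).2‖ / 2) • ldir (G.sepVec (z i).1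 (z j).1) ξ; Function.update (Function.update z i ((z i).1, c + w)) j ((z j).1, c - w); let lstep : ℝ → (N : ℕ) → EuclideanSpace ℝ (Fin 3) → Cfg N → Cfg N := fun σ N ξ z => let z' := S (τ σ N z).toReal N z; if τ σ N z = ⊤ then z else if h : (Literature.Analysis.FluidPDE.Alexander.incomingPairs G (ε σ N) z').Nonempty then lpair N h.some.1 h.some.2 z' ξ else z'; let lstate : ℝ → (N : ℕ) → (ℕ → EuclideanSpace ℝ (Fin 3)) → Cfg N → ℕ → Cfg N := fun σ N ξs z k => ((fun p : Cfg N × ℕ => (lstep σ N (ξs p.2) p.1, p.2 + 1))^[k] (z, 0)).1; let linst : ℝ → (N : ℕ) → (ℕ → EuclideanSpace ℝ (Fin 3)) → Cfg N → ℕ → ENNReal := fun σ N ξs z k => ∑ m ∈ Finset.range k, τ σ N (lstate σ N ξs z m); let lflow : ℝ → (N : ℕ) → (ℕ → EuclideanSpace ℝ (Fin 3)) → Cfg N → ℝ → Cfg N := fun σ N ξs z t => let K := sSup {k : ℕ | linst σ N ξs z k ≤ ENNReal.ofReal t}; S (t - (linst σ N ξs z K).toReal) N (lstate σ N ξs z K);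 let noise : MeasureTheory.Measure (ℕ → EuclideanSpace ℝ (Fin 3)) := MeasureTheory.Measure.infinitePi (fun _ : ℕ => ProbabilityTheory.stdGaussian (EuclideanSpace ℝ (Fin 3))); let fld : (N : ℕ) → Cfg N → ((UnitAddTorus (Fin 3)) → ℝ) → ℝ × (EuclideanSpace ℝ (Fin 3)) × ℝ := fun _ z χ => (Literature.MathematicalPhysics.KineticTheory.empiricalDensityField z χ, Literature.MathematicalPhysics.KineticTheory.empiricalMomentumField z χ, Literature.MathematicalPhysics.KineticTheory.empiricalEnergyField z χ); ∀ (a₀ θ₀ : (UnitAddTorus (Fin 3)) → ℝ) (u₀ : (UnitAddTorus (Fin 3)) → EuclideanSpace ℝ (Fin 3)), Continuous a₀ → Continuous θ₀ → Continuous u₀ → (∀ x, 0 < a₀ x) → (∀ x, 0 < θ₀ x) → ∃ σ₀ : ℝ, 0 < σ₀ ∧ ∀ σ : ℝ, 0 < σ → σ < σ₀ → ∀ (T : ℝ) (ρ θ : ℝ → (UnitAddTorus (Fin 3)) → ℝ) (u : ℝ → (UnitAddTorus (Fin 3)) → EuclideanSpace ℝ (Fin 3)), Literature.MathematicalPhysics.KineticTheory.IsHardSphereEulerSolution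 σ T ρ u θ → ∀ Φ : (N : ℕ) → Literature.Analysis.FluidPDE.HardSphereFlow G (ε σ N) (N + 1), let P := fun N => Literature.MathematicalPhysics.KineticTheory.localGibbsLaw σ a₀ u₀ θ₀ N (Φ N); Literature.MathematicalPhysics.KineticTheory.TendstoHydroFieldsAt P Φ ρ u θ 0 → ∀ t ∈ Set.Ico 0 T, ∀ χ : (UnitAddTorus (Fin 3)) → ℝ, Continuous χ → ∀ F : ℝ × (EuclideanSpace ℝ (Fin 3)) × ℝ → ℝ, LipschitzWith 1 F → (∀ y, |F y| ≤ 1) → Filter.Tendsto (fun N : ℕ => (∫ z, F (fld N ((Φ N).flow t z) χ) ∂(P N)) - ∫ p, F (fld N (lflow σ N p.2 p.1 t) χ) ∂((P N).prod noise)) Filter.atTop (nhds 0)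

/-- item stmt-AtomisticToContinuum-11854 · crux · rank 3 · open · by planner
why it might fail: true kinetic energy |v|²/2 (HighMomentumCutoff: OVY need bounded ∇(kinetic energy) for the cubic energy-current LD bounds), and the ergodic theorem must come from noise acting ONLY on collision angles with deterministic partner selection (degenerate; cf. card angles-are-not-enough Prop A).
sources: OllaVaradhanYau1993, FritzFunakiLebowitz1994, LiveraniOlla1996, CometsEtAl2008, Rezakhanlou2003
[crux] EULER FOR THE LAMBERTIAN GAS (verbatim the retired routes' shared node
stmt-AtomisticToContinuum-4434 = card crux 3 'EulerHS0'): same quantifiers as the conjunct; under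
P_N ⊗ γ^ℕ the χ-tested empirical density, momentum and energy fields of Λ_N,t converge in
probability to ∫χρ_t, ∫χρ_t u_t, ∫χE_t for every t < T. Expected proof: OVY relative entropy method
with the conservative angular collision noise supplying the ergodic decomposition; same EOS (Gibbs
laws are Λ-invariant). [difficulty: open-problem] -/
@[route_item "route-AtomisticToContinuum-LambertianContactSwap", crux]
def LambertianEuler : Prop :=
  let Cfg : ℕ → Type := fun N => Literature.Analysis.FluidPDE.Config (N + 1) (Fin 3) (UnitAddTorus (Fin 3)); let G := Literature.Analysis.FluidPDE.Torus.geometry (Fin 3); let ε : ℝ → ℕ → ℝ := Literature.MathematicalPhysics.KineticTheory.hsDiameter; let τ : ℝ → (N : ℕ) → Cfg N → ENNReal := fun σ N z => Literature.Analysis.FluidPDE.Alexander.freeExitTime G (ε σ N) z; let S : ℝ → (N : ℕ) → Cfg N → Cfg N := fun t _ z => Literature.Analysis.FluidPDE.freeFlight G t z; let ldir : EuclideanSpace ℝ (Fin 3) → EuclideanSpace ℝ (Fin 3) → EuclideanSpace ℝ (Fin 3) := fun ω ξ => ‖‖ω‖⁻¹ • ω + ‖ξ‖⁻¹ • ξ‖⁻¹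 • (‖ω‖⁻¹ • ω + ‖ξ‖⁻¹ • ξ); let lpair : (N : ℕ) → Fin (N + 1) → Fin (N + 1) → Cfg N → EuclideanSpace ℝ (Fin 3) → Cfg N := fun _ i j z ξ => let c := (2 : ℝ)⁻¹ • ((z i).2 + (z j).2); let w := (‖(z i).2 - (z j).2‖ / 2) • ldir (G.sepVec (z i).1 (z j).1) ξ; Function.update (Function.update z i ((z i).1, c + w)) j ((z j).1, c - w); let lstep : ℝ → (N : ℕ) → EuclideanSpace ℝ (Fin 3) → Cfg N → Cfg N := fun σ N ξ z => let z' := S (τ σ N z).toReal N z; if τ σ N z = ⊤ then z else if h : (Literature.Analysis.FluidPDE.Alexander.incomingPairs G (ε σ N) z').Nonempty then lpair N h.some.1 h.some.2 z' ξ else z'; let lstate : ℝ → (N : ℕ) → (ℕ → EuclideanSpace ℝ (Fin 3)) → Cfg N → ℕ → Cfg N := fun σ N ξs z k => ((fun p : Cfg N × ℕ => (lstep σ N (ξs p.2) p.1, p.2 + 1))^[k] (z, 0)).1; let linst : ℝ → (N : ℕ) → (ℕ → EuclideanSpace ℝ (Fin 3)) → Cfg N → ℕ → ENNReal := fun σ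 N ξs z k => ∑ m ∈ Finset.range k, τ σ N (lstate σ N ξs z m); let lflow : ℝ → (N : ℕ) → (ℕ → EuclideanSpace ℝ (Fin 3)) → Cfg N → ℝ → Cfg N := fun σ N ξs z t => let K := sSup {k : ℕ | linst σ N ξs z k ≤ ENNReal.ofReal t}; S (t - (linst σ N ξs z K).toReal) N (lstate σ N ξs z K); let noise : MeasureTheory.Measure (ℕ → EuclideanSpace ℝ (Fin 3)) := MeasureTheory.Measure.infinitePi (fun _ : ℕ => ProbabilityTheory.stdGaussian (EuclideanSpace ℝ (Fin 3))); ∀ (a₀ θ₀ : (UnitAddTorus (Fin 3)) → ℝ) (u₀ : (UnitAddTorus (Fin 3)) → EuclideanSpace ℝ (Fin 3)), Continuous a₀ → Continuous θ₀ → Continuous u₀ → (∀ x, 0 < a₀ x) → (∀ x, 0 < θ₀ x) → ∃ σ₀ : ℝ, 0 < σ₀ ∧ ∀ σ : ℝ, 0 < σ → σ < σ₀ → ∀ (T : ℝ) (ρ θ : ℝ → (UnitAddTorus (Fin 3)) → ℝ) (u : ℝ → (UnitAddTorus (Fin 3)) → EuclideanSpace ℝ (Fin 3)), Literature.MathematicalPhysics.KineticTheory.IsHardSphereEulerSolution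 σ T ρ u θ → ∀ Φ : (N : ℕ) → Literature.Analysis.FluidPDE.HardSphereFlow G (ε σ N) (N + 1), let P := fun N => Literature.MathematicalPhysics.KineticTheory.localGibbsLaw σ a₀ u₀ θ₀ N (Φ N); Literature.MathematicalPhysics.KineticTheory.TendstoHydroFieldsAt P Φ ρ u θ 0 → ∀ t ∈ Set.Ico 0 T, ∀ χ : (UnitAddTorus (Fin 3)) → ℝ, Continuous χ → ∀ δ > (0 : ℝ), Filter.Tendsto (fun N : ℕ => ((P N).prod noise) {p | δ < |Literature.MathematicalPhysics.KineticTheory.empiricalDensityField (lflow σ N p.2 p.1 t) χ - ∫ x, χ x * ρ t x|}) Filter.atTop (nhds 0) ∧ Filter.Tendsto (fun N : ℕ => ((P N).prod noise) {p | δ < ‖Literature.MathematicalPhysics.KineticTheory.empiricalMomentumField (lflow σ N p.2 p.1 t) χ - ∫ x, (χ x * ρ t x) • u t x‖}) Filter.atTop (nhds 0) ∧ Filter.Tendsto (fun N : ℕ => ((P N).prod noise) {p | δ < |Literature.MathematicalPhysics.KineticTheory.empiricalEnergyField (lflow σ N p.2 p.1 t) χ - ∫ x, χ x * Literature.MathematicalPhysics.KineticTheory.totalEnergyDensity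 (ρ t x) (u t x) (θ t x)|}) Filter.atTop (nhds 0)

/-- item stmt-AtomisticToContinuum-12097 · crux · rank 4 · open · by planner
why it might fail: exact in equilibrium; out of it, ring/recollision events (frequency O(σ³) at fixed density) correlate (g, ω) in proportion to local velocity gradients (Lutsko1996): the bet is this defect is O(φ·Kn) → 0; an O(φ) contact-anisotropy bias surviving N → ∞ kills it.
sources: Lutsko1996, ChernovDolgopyat2009, CanestrariLiveraniOlla2026, CIP1994, GST2013
[crux] CONTACT-NORMAL EQUIDISTRIBUTION GIVEN THE PAIR (card A1 in the restricted form the swap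
consumes; replaces the retired universal-ψ crux, which is false). For profiles, 0 < σ < σ₀, flows Φ,
any t ≥ 0 and any test functions ψ_N(s, x, v, v*, n) — measurable, |ψ| ≤ 1, 1-Lipschitz in the unit
normal n, depending on the collision ONLY through its instant s, midpoint x, incoming velocities v,
v* and normal — the normalised |g|²-weighted collision sum (N+1)^(-4/3) · E_(P_N) Σ_(collisions k ≤
t) |g_k|² [ψ_N(t_k, x_k, v_i, v_j, ω_k) − ∫ ψ_N(t_k, x_k, v_i, v_j, n) κ_(g_k)(dn)] → 0, where ω_k =
ε⁻¹·sepVec(x_i, x_j) is the contact normal of the k-th collision of the library's deterministic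
construction (lets zpre/tcol/Kt/hit over Alexander.stateAfter/collisionInstant/collisionCount,
contactSet, IsIncoming) and κ_g ∝ (n·ĝ)₋ dn is the kinematic cosine law (sampled as
normalize(−ĝ+ξ̂), ξ Gaussian). In words: given where, when and with which velocities a collision
happens, its impact geometry has no low-frequency bias, in |g|²-weighted collision average — exact
in equilibrium (positions ⊥ velocities, isotropic contact pair correlation), never a statement
conditional on the other spheres. [de -/
@[route_item "route-AtomisticToContinuum-LambertianContactSwap"]
def ContactAngleEquidistribution : Prop :=
  let Cfg : ℕ → Type := fun N => Literature.Analysis.FluidPDE.Config (N + 1) (Fin 3) (UnitAddTorus (Fin 3)); let G := Literature.Analysis.FluidPDE.Torus.geometry (Fin 3); let ε : ℝ → ℕ → ℝ := Literature.MathematicalPhysics.KineticTheory.hsDiameter; let τ : ℝ → (N : ℕ) → Cfg N → ENNReal := fun σ N z => Literature.Analysis.FluidPDE.Alexander.freeExitTime G (ε σ N) z; let S : ℝ → (N : ℕ) → Cfg N → Cfg N := fun t _ z => Literature.Analysis.FluidPDE.freeFlight G t z; let ldir : EuclideanSpace ℝ (Fin 3) → EuclideanSpace ℝ (Fin 3)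 → EuclideanSpace ℝ (Fin 3) := fun ω ξ => ‖‖ω‖⁻¹ • ω + ‖ξ‖⁻¹ • ξ‖⁻¹ • (‖ω‖⁻¹ • ω + ‖ξ‖⁻¹ • ξ); let zpre : ℝ → (N : ℕ) → Cfg N → ℕ → Cfg N := fun σ N z m => let y := Literature.Analysis.FluidPDE.Alexander.stateAfter G (ε σ N) z m; S (τ σ N y).toReal N y; let Kt : ℝ → (N : ℕ) → Cfg N → ℝ → ℕ := fun σ N z t => Literature.Analysis.FluidPDE.Alexander.collisionCount G (ε σ N) z t; let hit : ℝ → (N : ℕ) → Cfg N → Fin (N + 1) → Fin (N + 1) → Prop := fun σ N y i j => i < j ∧ y ∈ Literature.Analysis.FluidPDE.contactSet G (N + 1) (ε σ N) i j ∧ Literature.Analysis.FluidPDE.IsIncoming G y i j; let tcol : ℝ → (N : ℕ) → Cfg N → ℕ → ℝ := fun σ N z m => (Literature.Analysis.FluidPDE.Alexander.collisionInstant G (ε σ N) z (m + 1)).toReal; let xmid : (N : ℕ) → Cfg N → Fin (N + 1) → Fin (N + 1) → UnitAddTorus (Fin 3) := fun _ y i j => G.translate (y j).1 ((2 : ℝ)⁻¹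 • G.sepVec (y i).1 (y j).1); ∀ (a₀ θ₀ : (UnitAddTorus (Fin 3)) → ℝ) (u₀ : (UnitAddTorus (Fin 3)) → EuclideanSpace ℝ (Fin 3)), Continuous a₀ → Continuous θ₀ → Continuous u₀ → (∀ x, 0 < a₀ x) → (∀ x, 0 < θ₀ x) → ∃ σ₀ : ℝ, 0 < σ₀ ∧ ∀ σ : ℝ, 0 < σ → σ < σ₀ → ∀ Φ : (N : ℕ) → Literature.Analysis.FluidPDE.HardSphereFlow G (ε σ N) (N + 1), let P := fun N => Literature.MathematicalPhysics.KineticTheory.localGibbsLaw σ a₀ u₀ θ₀ N (Φ N); ∀ t : ℝ, 0 ≤ t → ∀ ψ : ℕ → ℝ → (UnitAddTorus (Fin 3)) → EuclideanSpace ℝ (Fin 3) → EuclideanSpace ℝ (Fin 3) → EuclideanSpace ℝ (Fin 3) → ℝ, (∀ N, Measurable (fun p : ℝ × (UnitAddTorus (Fin 3)) × (EuclideanSpace ℝ (Fin 3)) × (EuclideanSpace ℝ (Fin 3)) × EuclideanSpace ℝ (Fin 3) => ψ N p.1 p.2.1 p.2.2.1 p.2.2.2.1 p.2.2.2.2)) →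 (∀ N s x v w n, |ψ N s x v w n| ≤ 1) → (∀ N s x v w (n n' : EuclideanSpace ℝ (Fin 3)), ‖n‖ = 1 → ‖n'‖ = 1 → |ψ N s x v w n - ψ N s x v w n'| ≤ ‖n - n'‖) → Filter.Tendsto (fun N : ℕ => ∫ z, ((N : ℝ) + 1) ^ (-(4 / 3 : ℝ)) * ∑ m ∈ Finset.range (Kt σ N z t), ∑ i : Fin (N + 1), ∑ j : Fin (N + 1), (let y := zpre σ N z m; if hit σ N y i j then ‖(y i).2 - (y j).2‖ ^ 2 * (ψ N (tcol σ N z m) (xmid N y i j) (y i).2 (y j).2 ((ε σ N)⁻¹ • G.sepVec (y i).1 (y j).1) - ∫ ξ, ψ N (tcol σ N z m) (xmid N y i j) (y i).2 (y j).2 (ldir (-((y i).2 - (y j).2)) ξ) ∂(ProbabilityTheory.stdGaussian (EuclideanSpace ℝ (Fin 3)))) else 0) ∂(P N)) Filter.atTop (nhds 0)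

-- item stmt-AtomisticToContinuum-12488 · support · rank 5 · open · by planner — informal only, no Lean statement yet:
--   [crux] LAW-LEVEL LINEAR RESPONSE OF THE LAMBERTIAN GAS FROM DETERMINISTICALLY EVOLVED STATES (card
--   A2; second child of the foreseen split SwapGap ⇐ ContactAngleEquidistribution →
--   LambertianLinearResponse → SwapGap; to be typed once the Lambertian API — definition request
--   LambertianHardSphereFlow — is a named definition). For σ < σ₀, pre-shock t < T, P_N-typical
--   pre-collisional configurations z at the deterministic collision instants s, and smooth F of χ-tested
--   fields: with P⁰_u F(y) := E_γ F(Λ_u(y,·)), the map n ↦ (P⁰_(t−s)F)(lpair_n z) on the outgoing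
--   hemisphere is Lipschitz with constant ≤ C

/-- item stmt-AtomisticToContinuum-12098 · support · rank 9 · closed · proved by Summit.AtomisticToContinuum.HydrodynamicLimit.Theorems.localGibbsProbability_proof @ 67c9ca9d309f (prover) · by planner
sources: Ruelle1969, GST2013, Spohn1991
[support] LOCAL GIBBS LAWS ARE PROBABILITY MEASURES at small reduced density (provable now; σ₀ = 1/2
works): for 0 < σ < σ₀, continuous a₀, θ₀ > 0, u₀ and every N, localGibbsLaw σ a₀ u₀ θ₀ N Φ =
(liouville).withDensity(canonicalDensity) has total mass 1 — the canonical partition function is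
finite (Maxwellian tails, a₀ bounded on the compact torus) and POSITIVE because (N+1) spheres of
diameter σ(N+1)^(-1/3) < (1/2)(N+1)^(-1/3) ≤ 1/⌈(N+1)^(1/3)⌉ fit on a cubic sub-lattice of 𝕋³ with
an open neighbourhood to spare. Needed by the Markov step of MergingTransfer; cf.
CramerEdgeLadder.EquilibriumIsProbability (homogeneous profiles). [difficulty: provable-now] -/
@[route_item "route-AtomisticToContinuum-LambertianContactSwap", crux]
def LocalGibbsProbability : Prop :=
  ∃ σ₀ : ℝ, 0 < σ₀ ∧ ∀ σ : ℝ, 0 < σ → σ < σ₀ → ∀ (a₀ θ₀ : (UnitAddTorus (Fin 3)) → ℝ) (u₀ : (UnitAddTorus (Fin 3)) → EuclideanSpace ℝ (Fin 3)), Continuous a₀ → Continuous θ₀ → Continuous u₀ → (∀ x, 0 < a₀ x) → (∀ x, 0 < θ₀ x) → ∀ (N : ℕ) (Φ : Literature.Analysis.FluidPDE.HardSphereFlow (Literature.Analysis.FluidPDE.Torus.geometry (Fin 3)) (Literature.MathematicalPhysics.KineticTheory.hsDiameter σ N) (N + 1)), MeasureTheory.IsProbabilityMeasure (Literature.MathematicalPhysics.KineticTheory.localGibbsLaw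 σ a₀ u₀ θ₀ N Φ)

/-- item stmt-AtomisticToContinuum-12099 · support · rank 9 · closed · proved by Summit.AtomisticToContinuum.HydrodynamicLimit.Theorems.mergingTransfer_proof @ 07ce50dea127 (prover) · by planner
sources: OllaVaradhanYau1993, Billingsley1999, Dudley2002
[support] PORTMANTEAU TRANSFER (the typed glue of the deciding theorem; provable now). If the local
Gibbs laws are probability measures for small σ, the field laws of Φ_t and Λ_t merge (SwapGap) and
Λ's fields converge in probability to the Euler values (LambertianEuler), then the conjunct holds:
fix profiles, σ₀ := min of the three thresholds; for σ < σ₀, data, flows, the t = 0 hypothesis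
(passed verbatim to both cruxes), t < T, χ, δ: with the 1-Lipschitz [0,1]-valued F(d,m,e) := min(1,
(|d − ∫χρ_t| − δ/2)₊) one has min(1,δ/2)·P_N(δ < |density field(Φ_t z) − ∫χρ_t|) ≤ ∫F∘fields∘Φ_t
dP_N (Markov: bounded measurable integrand, P_N finite) = ∫F∘fields∘Λ_t d(P_N⊗γ^ℕ) + o(1) (SwapGap)
≤ (P_N⊗γ^ℕ)(δ/2 < |density field(Λ_t) − ∫χρ_t|) + o(1) (F ≤ indicator; if the Λ-integrand is not
a.e.-measurable its Bochner integral is 0 and the bound is trivial) → 0 (LambertianEuler at δ/2);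
likewise momentum (F of ‖m − ∫χρ_t u_t‖) and energy. The `let` blocks of SwapGap/LambertianEuler are
syntactically identical, so the Λ-terms match after zeta-reduction. [deps: LocalGibbsProbability,
SwapGap, LambertianEuler] [difficulty: provable-now] -/
@[route_item "route-AtomisticToContinuum-LambertianContactSwap"]
def MergingTransfer : Prop :=
  LocalGibbsProbability → SwapGap → LambertianEuler → Literature.MathematicalPhysics.KineticTheory.HydrodynamicLimit

/-- item stmt-AtomisticToContinuum-12100 · support · rank 9 · closed · proved by Summit.AtomisticToContinuum.HydrodynamicLimit.Theorems.swapIdentity_proof @ 657f3200cf4f (prover) · by planner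
sources: MischlerMouhot2012, Chatterjee2006, CIP1994
[support] THE EXACT HYBRID (TROTTER–LINDEBERG) IDENTITY (card A4(b); verbatim the retired item). For
0 < σ < 1/2, N, t ≥ 0, bounded measurable F, z in the good set Γ₀ of the library's construction and
almost surely non-accumulating Lambertian continuations (hypotheses): F(Φ_t z) − E_γ F(Λ_t(z,·)) =
Σ_(m < K_t(z)) [ (P⁰_(t−t_(m+1)) F)(collisionStep z_m) − ∫ (P⁰_(t−t_(m+1)) F)(lstep_ξ z_m) γ(dξ) ],
with P⁰_u F(y) := E_γ F(Λ_u(y,·)) and z_m = stateAfter z m: telescoping H_m := P⁰_(t−t_m)F(z_m) over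
the deterministic collision sequence (H_K = F(Φ_t z) since both gases share free flight and exit
times; H_0 = P⁰_t F(z)), the restart property lstate (ξ_0, ξ') y (k+1) = lstate ξ' (lstep ξ_0 y) k
and Fubini for γ^ℕ ≅ γ ⊗ γ^ℕ (Measure.infinitePi). N + 1 = 2 is the unit test. [deps:
LambertianWellPosed] [difficulty: provable-now] -/
@[route_item "route-AtomisticToContinuum-LambertianContactSwap"]
def SwapIdentity : Prop :=
  let Cfg : ℕ → Type := fun N => Literature.Analysis.FluidPDE.Config (N + 1) (Fin 3) (UnitAddTorus (Fin 3)); let G := Literature.Analysis.FluidPDE.Torus.geometry (Fin 3); let ε : ℝ → ℕ → ℝ := Literature.MathematicalPhysics.KineticTheory.hsDiameter; let τ : ℝ → (N : ℕ) → Cfg N → ENNReal := fun σ N z => Literature.Analysis.FluidPDE.Alexander.freeExitTime G (ε σ N) z; let S : ℝ → (N : ℕ) → Cfg N → Cfg N := fun t _ z => Literature.Analysis.FluidPDE.freeFlight G t z; let ldir : EuclideanSpace ℝ (Fin 3) → EuclideanSpace ℝ (Fin 3) → EuclideanSpace ℝ (Fin 3) := fun ω ξ => ‖‖ω‖⁻¹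 • ω + ‖ξ‖⁻¹ • ξ‖⁻¹ • (‖ω‖⁻¹ • ω + ‖ξ‖⁻¹ • ξ); let lpair : (N : ℕ) → Fin (N + 1) → Fin (N + 1) → Cfg N → EuclideanSpace ℝ (Fin 3) → Cfg N := fun _ i j z ξ => let c := (2 : ℝ)⁻¹ • ((z i).2 + (z j).2); let w := (‖(z i).2 - (z j).2‖ / 2) • ldir (G.sepVec (z i).1 (z j).1) ξ; Function.update (Function.update z i ((z i).1, c + w)) j ((z j).1, c - w); let lstep : ℝ → (N : ℕ) → EuclideanSpace ℝ (Fin 3) → Cfg N → Cfg N := fun σ N ξ z => let z' := S (τ σ N z).toReal N z; if τ σ N z = ⊤ then z else if h : (Literature.Analysis.FluidPDE.Alexander.incomingPairs G (ε σ N) z').Nonempty then lpair N h.some.1 h.some.2 z' ξ else z'; let lstate : ℝ → (N : ℕ) → (ℕ → EuclideanSpace ℝ (Fin 3)) → Cfg N → ℕ → Cfg N := fun σ N ξs z k => ((fun p : Cfg N × ℕ => (lstep σ N (ξs p.2) p.1, p.2 + 1))^[k] (z, 0)).1; let linst : ℝ → (N : ℕ) → (ℕ → EuclideanSpace ℝ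 (Fin 3)) → Cfg N → ℕ → ENNReal := fun σ N ξs z k => ∑ m ∈ Finset.range k, τ σ N (lstate σ N ξs z m); let lflow : ℝ → (N : ℕ) → (ℕ → EuclideanSpace ℝ (Fin 3)) → Cfg N → ℝ → Cfg N := fun σ N ξs z t => let K := sSup {k : ℕ | linst σ N ξs z k ≤ ENNReal.ofReal t}; S (t - (linst σ N ξs z K).toReal) N (lstate σ N ξs z K); let noise : MeasureTheory.Measure (ℕ → EuclideanSpace ℝ (Fin 3)) := MeasureTheory.Measure.infinitePi (fun _ : ℕ => ProbabilityTheory.stdGaussian (EuclideanSpace ℝ (Fin 3))); ∀ σ : ℝ, 0 < σ → σ < 2⁻¹ → ∀ (N : ℕ) (t : ℝ), 0 ≤ t → (∀ s : ℝ, Measurable (fun p : Cfg N × (ℕ → EuclideanSpace ℝ (Fin 3)) => lflow σ N p.2 p.1 s)) → ∀ F : Cfg N → ℝ, Measurable F → (∀ z, |F z| ≤ 1) → ∀ z ∈ Literature.Analysis.FluidPDE.Alexander.good G (ε σ N), (∀ m : ℕ, ∀ᵐ ξs ∂noise, ∑' k, τ σ N (lstate σ N ξs (Literature.Analysis.FluidPDE.Alexander.stateAfter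 G (ε σ N) z m) k) = ⊤) → (let PF : ℝ → Cfg N → ℝ := fun s y => ∫ ξs, F (lflow σ N ξs y s) ∂noise; F (Literature.Analysis.FluidPDE.Alexander.fwdFlow G (ε σ N) z t) - PF t z = ∑ m ∈ Finset.range (Literature.Analysis.FluidPDE.Alexander.collisionCount G (ε σ N) z t), (let s := t - (Literature.Analysis.FluidPDE.Alexander.collisionInstant G (ε σ N) z (m + 1)).toReal; PF s (Literature.Analysis.FluidPDE.Alexander.collisionStep G (ε σ N) (Literature.Analysis.FluidPDE.Alexander.stateAfter G (ε σ N) z m)) - ∫ ξ, PF s (lstep σ N ξ (Literature.Analysis.FluidPDE.Alexander.stateAfter G (ε σ N) z m)) ∂(ProbabilityTheory.stdGaussian (EuclideanSpace ℝ (Fin 3)))))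

/-- item stmt-AtomisticToContinuum-12101 · support · rank 9 · closed · proved by Summit.AtomisticToContinuum.HydrodynamicLimit.Theorems.LambertianContactSwapLambertianEulerLiouville.lambertianWellPosed_holds @ d78c486a5fa7 (prover) · by planner
sources: GST2013, CIP1994, CometsEtAl2008, FeresYablonsky2004, Alexander1975
[support] ALEXANDER'S THEOREM FOR THE LAMBERTIAN FLOW (verbatim the retired item): for 0 < σ < 1/2
and every N, (a) (z, ξ) ↦ Λ_t(z, ξ) is jointly measurable for each t (the choice `Set.Nonempty.some`
factors through the finitely-valued measurable map z ↦ incomingPairs, so it does not obstruct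
measurability); (b) for Liouville ⊗ γ^ℕ-a.e. (z, ξ) every finite exit configuration of the ξ-driven
recursion is a simple incoming collision, no pair touches strictly inside a free flight, and the
exit times sum to ∞ (the three FwdGood clauses for lstate). Same flux/measure-preservation argument
as torusFlow_ae_good_holds / torusFlow_measurable_holds: the cosine redraw maps the incoming flux
measure |g·ω|dS onto the outgoing one, so Liouville is Λ-invariant (one-particle random billiards:
CometsEtAl2008, FeresYablonsky2004). [difficulty: M] -/
@[route_item "route-AtomisticToContinuum-LambertianContactSwap"]
def LambertianWellPosed : Prop :=
  let Cfg : ℕ → Type := fun N => Literature.Analysis.FluidPDE.Config (N + 1) (Fin 3) (UnitAddTorus (Fin 3)); let G := Literature.Analysis.FluidPDE.Torus.geometry (Fin 3); let ε : ℝ → ℕ → ℝ := Literature.MathematicalPhysics.KineticTheory.hsDiameter; let τ : ℝ → (N : ℕ) → Cfg N → ENNReal := fun σ N z => Literature.Analysis.FluidPDE.Alexander.freeExitTime G (ε σ N) z; let S : ℝ → (N : ℕ) → Cfg N → Cfg N := fun t _ z => Literature.Analysis.FluidPDE.freeFlight G t z; let ldir : EuclideanSpace ℝ (Fin 3) → EuclideanSpace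 ℝ (Fin 3) → EuclideanSpace ℝ (Fin 3) := fun ω ξ => ‖‖ω‖⁻¹ • ω + ‖ξ‖⁻¹ • ξ‖⁻¹ • (‖ω‖⁻¹ • ω + ‖ξ‖⁻¹ • ξ); let lpair : (N : ℕ) → Fin (N + 1) → Fin (N + 1) → Cfg N → EuclideanSpace ℝ (Fin 3) → Cfg N := fun _ i j z ξ => let c := (2 : ℝ)⁻¹ • ((z i).2 + (z j).2); let w := (‖(z i).2 - (z j).2‖ / 2) • ldir (G.sepVec (z i).1 (z j).1) ξ; Function.update (Function.update z i ((z i).1, c + w)) j ((z j).1, c - w); let lstep : ℝ → (N : ℕ) → EuclideanSpace ℝ (Fin 3) → Cfg N → Cfg N := fun σ N ξ z => let z' := S (τ σ N z).toReal N z; if τ σ N z = ⊤ then z else if h : (Literature.Analysis.FluidPDE.Alexander.incomingPairs G (ε σ N) z').Nonempty then lpair N h.some.1 h.some.2 z' ξ else z'; let lstate : ℝ → (N : ℕ) → (ℕ → EuclideanSpace ℝ (Fin 3)) → Cfg N → ℕ → Cfg N := fun σ N ξs z k => ((fun p : Cfg N × ℕ => (lstep σ N (ξs p.2) p.1, p.2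 + 1))^[k] (z, 0)).1; let linst : ℝ → (N : ℕ) → (ℕ → EuclideanSpace ℝ (Fin 3)) → Cfg N → ℕ → ENNReal := fun σ N ξs z k => ∑ m ∈ Finset.range k, τ σ N (lstate σ N ξs z m); let lflow : ℝ → (N : ℕ) → (ℕ → EuclideanSpace ℝ (Fin 3)) → Cfg N → ℝ → Cfg N := fun σ N ξs z t => let K := sSup {k : ℕ | linst σ N ξs z k ≤ ENNReal.ofReal t}; S (t - (linst σ N ξs z K).toReal) N (lstate σ N ξs z K); let noise : MeasureTheory.Measure (ℕ → EuclideanSpace ℝ (Fin 3)) := MeasureTheory.Measure.infinitePi (fun _ : ℕ => ProbabilityTheory.stdGaussian (EuclideanSpace ℝ (Fin 3))); ∀ σ : ℝ, 0 < σ → σ < 2⁻¹ → ∀ N : ℕ, (∀ t : ℝ, Measurable (fun p : Cfg N × (ℕ → EuclideanSpace ℝ (Fin 3)) => lflow σ N p.2 p.1 t)) ∧ ∀ᵐ p ∂((Literature.Analysis.FluidPDE.liouville G (N + 1) (ε σ N)).prod noise), (let L := lstate σ N p.2 p.1; ((∀ k, τ σ N (L k) ≠ ⊤ → Literature.Analysis.FluidPDE.Alexander.IsSimpleIncoming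 G (ε σ N) (S (τ σ N (L k)).toReal N (L k))) ∧ (∀ k (s : ℝ), 0 < s → ENNReal.ofReal s < τ σ N (L k) → ∀ i j : Fin (N + 1), i ≠ j → S s N (L k) ∉ Literature.Analysis.FluidPDE.contactSet G (N + 1) (ε σ N) i j) ∧ ∑' k, τ σ N (L k) = ⊤))

/-- item stmt-AtomisticToContinuum-12102 · support · rank 9 · open · by planner
sources: Spohn1991, KipnisLandim1999, CIP1994, GST2013
[support] A-PRIORI COLLISION FLUX MOMENTS (card A5; verbatim the retired item; module shared with
card apriori-tails-and-rattlers): for profiles, 0 < σ < σ₀, t ≥ 0 there is C with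
E_(P_N)[(N+1)^(-4/3) Σ_(collisions k ≤ t) (1 + |g_k|³)] ≤ C for all N (normalised |g|³-weighted
collision count of the deterministic flow under local Gibbs data; expected size O(σ²)). Makes the
sums in ContactAngleEquidistribution and in SwapIdentity's use O(1) and non-vacuous. CAVEAT recorded
for provers: the entropy-inequality route (relative entropy O(N) w.r.t. the invariant Gibbs law +
exponential moments under equilibrium) FAILS for the cubic weight — a sphere of speed V contributes
≍ σ²tV⁴ to N^(-1/3)Σ|g|³ against the Gaussian weight e^(−V²/2θ) — so a first-moment argument through
the flux (contact) measure of the time-evolved law is needed; this is the HighMomentumCutoff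
instance of the line. [difficulty: L] -/
@[route_item "route-AtomisticToContinuum-LambertianContactSwap"]
def CollisionMomentBound : Prop :=
  let Cfg : ℕ → Type := fun N => Literature.Analysis.FluidPDE.Config (N + 1) (Fin 3) (UnitAddTorus (Fin 3)); let G := Literature.Analysis.FluidPDE.Torus.geometry (Fin 3); let ε : ℝ → ℕ → ℝ := Literature.MathematicalPhysics.KineticTheory.hsDiameter; let τ : ℝ → (N : ℕ) → Cfg N → ENNReal := fun σ N z => Literature.Analysis.FluidPDE.Alexander.freeExitTime G (ε σ N) z; let S : ℝ → (N : ℕ) → Cfg N → Cfg N := fun t _ z => Literature.Analysis.FluidPDE.freeFlight G t z; let zpre : ℝ → (N : ℕ) → Cfg N → ℕ → Cfg N := fun σ N z m => let y := Literature.Analysis.FluidPDE.Alexander.stateAfter G (ε σ N) z m; S (τ σ N y).toReal N y; let Kt : ℝ → (N : ℕ) → Cfg N → ℝ → ℕ := fun σ N z t => Literature.Analysis.FluidPDE.Alexander.collisionCount G (ε σ N) z t; let hit : ℝ → (N : ℕ) → Cfg N → Fin (N + 1) → Fin (N + 1) → Prop := fun σ N y i j => i < j ∧ y ∈ Literature.Analysis.FluidPDE.contactSet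 G (N + 1) (ε σ N) i j ∧ Literature.Analysis.FluidPDE.IsIncoming G y i j; ∀ (a₀ θ₀ : (UnitAddTorus (Fin 3)) → ℝ) (u₀ : (UnitAddTorus (Fin 3)) → EuclideanSpace ℝ (Fin 3)), Continuous a₀ → Continuous θ₀ → Continuous u₀ → (∀ x, 0 < a₀ x) → (∀ x, 0 < θ₀ x) → ∃ σ₀ : ℝ, 0 < σ₀ ∧ ∀ σ : ℝ, 0 < σ → σ < σ₀ → ∀ Φ : (N : ℕ) → Literature.Analysis.FluidPDE.HardSphereFlow G (ε σ N) (N + 1), let P := fun N => Literature.MathematicalPhysics.KineticTheory.localGibbsLaw σ a₀ u₀ θ₀ N (Φ N); ∀ t : ℝ, 0 ≤ t → ∃ C : ℝ, ∀ N : ℕ, ∫⁻ z, ENNReal.ofReal (((N : ℝ) + 1) ^ (-(4 / 3 : ℝ)) * ∑ m ∈ Finset.range (Kt σ N z t), ∑ i : Fin (N + 1), ∑ j : Fin (N + 1), (let y := zpre σ N z m; if hit σ N y i j then 1 + ‖((y i).2 - (y j).2)‖ ^ 3 else 0)) ∂(P N) ≤ ENNReal.ofReal C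

-- earlier Assembly (stmt-AtomisticToContinuum-12103, replaced 2026-08-16T12:09:28Z -> stmt-AtomisticToContinuum-11856): retired by None — SwapGap → LambertianEuler → LocalGibbsProbability → MergingTransfer → HydrodynamicLimit
/-- item stmt-AtomisticToContinuum-11856 · assembly · rank 1 · closed · proved by Summit.AtomisticToContinuum.HydrodynamicLimit.Theorems.lindebergRandomFuture_assembly_proof @ 037849741836 (prover) · by planner
sources: OllaVaradhanYau1993, Spohn1991
[assembly] THE DOCK (portmanteau plumbing, the last step of `closes`; same content as the retired
routes' assembly stmt-AtomisticToContinuum-4444, now concluding the Statement decl by name): SwapGap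
→ LambertianEuler → HydrodynamicLimit. Fix profiles, σ₀ := min of the two σ₀'s; for σ < σ₀, a
classical solution on [0,T), flows Φ, the t = 0 hypothesis, t < T, χ, δ: with the 1-Lipschitz
bounded F = min(1, (|d − ∫χρ_t| − δ/2)₊ ∧ δ/2) one has min(1,δ/2)·P_N(δ < |density field(Φ_t z) −
∫χρ_t|) ≤ ∫F∘fields∘Φ_t dP_N = ∫F∘fields∘Λ_t d(P_N⊗γ^ℕ) + o(1) (SwapGap) ≤ (P_N⊗γ^ℕ)(δ/2 < |density
field(Λ_t) − ∫χρ_t|) + o(1) → 0 (LambertianEuler); likewise momentum and energy: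
TendstoHydroFieldsAt at every t < T, i.e. the conjunct profile by profile (hydrodynamicLimit_iff). -/
@[route_item "route-AtomisticToContinuum-LambertianContactSwap"]
def Assembly : Prop :=
  SwapGap → LambertianEuler → _root_.HydrodynamicLimit

/-! D-0027 §2.1 — DECIDING THEOREM (planner-authored via `route open/edit --closes-file`; by planner-rbadge-AtomisticToContinuum-Lambertian-3a6e8fe6-g2-0 2026-08-16T23:41:44Z):
its hypotheses are this route's items and its conclusion the sub-problem Statement (glue_lint), and it elaborates with this file. -/

/-- D-0027 §2.1 deciding theorem of route LambertianContactSwap, PROVED glue (no support/assembly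
hypothesis), re-elaborated 2026-08-16 for the re-typed packing-guarded conjunct (p126922), then
re-submitted unchanged after a stale fullbuild stamp on the rev-5 glue (`intro a₀` at 519:8).
`SwapGap` (bounded-Lipschitz merging of the field laws of `Φ_t` and `Λ_t`) and `LambertianEuler`
(convergence in probability of `Λ`'s fields) are UNGUARDED (every classical solution on `[0,T)`),
so `η₀ := 1` works and the guard is discarded (cf. `HydrodynamicLimit.of_unguarded`). Per field and
`δ > 0`, with the `1`-Lipschitz cutoff `g = min 1 (max (· - δ/2) 0)`: `min(1,δ/2)·P_N{δ < dev Φ_t}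
≤ ∫ g∘dev∘Φ_t dP_N` (Markov; `P_N` finite, fields measurable) `= ∫ g∘dev∘Λ_t d(P_N⊗γ^ℕ) + o(1)`
(`SwapGap`) `≤ (P_N⊗γ^ℕ){δ/2 < dev Λ_t} + o(1) → 0` (`LambertianEuler`). [Billingsley1999 Thm 2.1] -/
@[closes "route-AtomisticToContinuum-LambertianContactSwap"] theorem closes (hS : SwapGap) (hL : LambertianEuler) : _root_.HydrodynamicLimit := by
  refine ⟨1, one_pos, ?_⟩ -- packing threshold `η₀ := 1` (cruxes unguarded)
  intro a₀ θ₀ u₀ ha hθ hu ha0 hθ0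
  obtain ⟨σS, hσS, hS'⟩ := hS a₀ θ₀ u₀ ha hθ hu ha0 hθ0
  obtain ⟨σL, hσL, hL'⟩ := hL a₀ θ₀ u₀ ha hθ hu ha0 hθ0
  refine ⟨min σS σL, lt_min hσS hσL, ?_⟩
  intro σ hσ hσlt T ρ θ u hE _hη Φ h0 t ht χ hχ δ hδ -- `_hη`: packing guard, unused
  have hSw := hS' σ hσ (hσlt.trans_le (min_le_left _ _)) T ρ θ u hE Φ h0 t ht χ hχ
  have hLa := hL' σ hσ (hσlt.trans_le (min_le_right _ _)) T ρ θ u hE Φ h0 t ht χ hχ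
  clear hS' hL'
  -- abstract merging transfer: finite `μ n`, measurable real `X n`, arbitrary real `Y n`
  have key : ∀ {α β : ℕ → Type} [∀ n, MeasurableSpace (α n)] [∀ n, MeasurableSpace (β n)]
      (μ : ∀ n, Measure (α n)) (ν : ∀ n, Measure (β n)), (∀ n, IsFiniteMeasure (μ n)) →
      ∀ (X : ∀ n, α n → ℝ) (Y : ∀ n, β n → ℝ), (∀ n, Measurable (X n)) →
      (∀ g : ℝ → ℝ, LipschitzWith 1 g → (∀ y, |g y| ≤ 1) →
        Tendsto (fun n => (∫ z, g (X n z) ∂μ n) - ∫ p, g (Y n p) ∂ν n) atTop (𝓝 0)) →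
      (∀ δ' : ℝ, 0 < δ' → Tendsto (fun n => ν n {p | δ' < Y n p}) atTop (𝓝 0)) →
      ∀ δ' : ℝ, 0 < δ' → Tendsto (fun n => μ n {z | δ' < X n z}) atTop (𝓝 0) := by
    intro α β _ _ μ ν hμ X Y hX hswap hY δ hδ
    obtain ⟨g, hgl, hga, hg0, hg1, hgz, hgδ⟩ : ∃ g : ℝ → ℝ, LipschitzWith 1 g ∧ (∀ x, |g x| ≤ 1) ∧
        (∀ x, 0 ≤ g x) ∧ (∀ x, g x ≤ 1) ∧ (∀ x, x ≤ δ / 2 → g x = 0) ∧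
        (∀ x, δ < x → min 1 (δ / 2) ≤ g x) := by
      have hnn : ∀ x : ℝ, 0 ≤ min 1 (max (x - δ / 2) 0) :=
        fun x => le_min zero_le_one (le_max_right _ _)
      refine ⟨fun x => min 1 (max (x - δ / 2) 0), ?_, ?_, hnn, fun x => min_le_left _ _, ?_, ?_⟩
      · refine LipschitzWith.mk_one fun x y => ?_
        rw [Real.dist_eq, Real.dist_eq]
        calc |min 1 (max (x - δ / 2) 0) - min 1 (max (y - δ / 2) 0)|
            ≤ max |(1 : ℝ) - 1| |max (x - δ / 2) 0 - max (y - δ / 2) 0| :=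
              abs_min_sub_min_le_max _ _ _ _
          _ = |max (x - δ / 2) 0 - max (y - δ / 2) 0| := by
              rw [sub_self, abs_zero, max_eq_right (abs_nonneg _)]
          _ ≤ |x - δ / 2 - (y - δ / 2)| := abs_max_sub_max_le_abs _ _ _
          _ = |x - y| := by rw [sub_sub_sub_cancel_right]
      · exact fun x => by rw [abs_of_nonneg (hnn x)]; exact min_le_left _ _
      · exact fun x hx => show min 1 (max (x - δ / 2) 0) = 0 by
          rw [max_eq_right (sub_nonpos.2 hx), min_eq_right zero_le_one]
      · exact fun x hx => le_min (min_le_left _ _)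
          ((min_le_right _ _).trans (le_max_of_le_left (by linarith)))
    have hκ : 0 < min 1 (δ / 2) := lt_min one_pos (half_pos hδ)
    have hb0 : ∀ n, 0 ≤ ∫ p, g (Y n p) ∂ν n := fun n => integral_nonneg fun p => hg0 _
    have hb_le : ∀ n, ENNReal.ofReal (∫ p, g (Y n p) ∂ν n) ≤ ν n {p | δ / 2 < Y n p} := by
      intro n
      have h1 : ENNReal.ofReal (∫ p, g (Y n p) ∂ν n) ≤ ∫⁻ p, ENNReal.ofReal (g (Y n p)) ∂ν n := by
        by_cases hf : Integrable (fun p => g (Y n p)) (ν n)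
        · rw [ofReal_integral_eq_lintegral_ofReal hf (Eventually.of_forall fun p => hg0 _)]
        · rw [integral_undef hf, ENNReal.ofReal_zero]
          exact zero_le
      refine h1.trans ((lintegral_mono fun p => ?_).trans (lintegral_indicator_one_le _))
      by_cases hp : δ / 2 < Y n p
      · rw [Set.indicator_of_mem (show p ∈ {p | δ / 2 < Y n p} from hp), Pi.one_apply]
        exact ENNReal.ofReal_le_one.2 (hg1 _)
      · rw [Set.indicator_of_notMem (show p ∉ {p | δ / 2 < Y n p} from hp),
          hgz _ (not_lt.1 hp), ENNReal.ofReal_zero]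
    have hb : Tendsto (fun n => ∫ p, g (Y n p) ∂ν n) atTop (𝓝 0) := by
      have h1 : Tendsto (fun n => ENNReal.ofReal (∫ p, g (Y n p) ∂ν n)) atTop (𝓝 0) :=
        tendsto_of_tendsto_of_tendsto_of_le_of_le tendsto_const_nhds (hY _ (half_pos hδ))
          (fun n => zero_le) hb_le
      exact ((ENNReal.tendsto_toReal_zero_iff (fun n => ENNReal.ofReal_ne_top)).2 h1).congr
        fun n => ENNReal.toReal_ofReal (hb0 n)
    have ha : Tendsto (fun n => ∫ z, g (X n z) ∂μ n) atTop (𝓝 0) := by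
      simpa using (hswap g hgl hga).add hb
    have hA : ∀ n, MeasurableSet {z | δ < X n z} :=
      fun n => measurableSet_lt measurable_const (hX n)
    have ha_ge : ∀ n, min 1 (δ / 2) * (μ n {z | δ < X n z}).toReal ≤ ∫ z, g (X n z) ∂μ n := by
      intro n
      haveI := hμ n
      have hint : Integrable (fun z => g (X n z)) (μ n) :=
        Integrable.of_bound (hgl.continuous.measurable.comp (hX n)).aestronglyMeasurable 1
          (Eventually.of_forall fun z => by rw [Real.norm_eq_abs]; exact hga (X n z))
      calc min 1 (δ / 2) * (μ n {z | δ < X n z}).toReal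
          = ∫ z, {z | δ < X n z}.indicator (fun _ => min 1 (δ / 2)) z ∂μ n := by
            rw [integral_indicator_const _ (hA n), smul_eq_mul, measureReal_def, mul_comm]
        _ ≤ ∫ z, g (X n z) ∂μ n := by
            refine integral_mono ((integrable_const _).indicator (hA n)) hint fun z => ?_
            by_cases hz : δ < X n z
            · rw [Set.indicator_of_mem (show z ∈ {z | δ < X n z} from hz)]
              exact hgδ _ hz
            · rw [Set.indicator_of_notMem (show z ∉ {z | δ < X n z} from hz)]
              exact hg0 _
    refine (ENNReal.tendsto_toReal_zero_iff fun n => ?_).1 ?_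
    · haveI := hμ n
      exact measure_ne_top _ _
    have h0 : Tendsto (fun n => (min 1 (δ / 2))⁻¹ * ∫ z, g (X n z) ∂μ n) atTop (𝓝 0) := by
      simpa using ha.const_mul (min 1 (δ / 2))⁻¹
    refine tendsto_of_tendsto_of_tendsto_of_le_of_le tendsto_const_nhds h0
      (fun n => ENNReal.toReal_nonneg) fun n => ?_
    rw [le_inv_mul_iff₀ hκ]
    exact ha_ge n
  -- local Gibbs laws are finite for all `σ, N`: `1_D f₀^⊗(N+1)` integrable, or `𝒵 = 0` (zero law)
  have aux : ∀ {α : Type} [MeasureSpace α] (f : α → ℝ) (s : Set α),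
      ∫⁻ z in s, ENNReal.ofReal ((∫ z, f z)⁻¹ * f z) < ⊤ := by
    intro α _ f s
    by_cases hint : Integrable f volume
    · exact lt_of_le_of_lt (lintegral_mono' Measure.restrict_le_self fun z => Real.ofReal_le_enorm _)
        (hasFiniteIntegral_iff_enorm.1 (hint.const_mul _).hasFiniteIntegral)
    · simp [integral_undef hint]
  have hfinP : ∀ N, IsFiniteMeasure (Literature.MathematicalPhysics.KineticTheory.localGibbsLaw σ a₀ u₀ θ₀ N (Φ N)) := fun N =>
    ⟨by
      show (volume.restrict _).withDensity _ Set.univ < ⊤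
      rw [withDensity_apply _ MeasurableSet.univ, Measure.restrict_univ]
      exact aux _ _⟩
  -- measurability of the empirical fields (finite averages, `χ` continuous)
  have hpos : ∀ {N : ℕ} (i : Fin (N + 1)),
      Measurable fun z : Literature.Analysis.FluidPDE.Config (N + 1) (Fin 3) (UnitAddTorus (Fin 3)) => (z i).1 :=
    fun i => (measurable_pi_apply i).fst
  have hvel : ∀ {N : ℕ} (i : Fin (N + 1)),
      Measurable fun z : Literature.Analysis.FluidPDE.Config (N + 1) (Fin 3) (UnitAddTorus (Fin 3)) => (z i).2 :=
    fun i => (measurable_pi_apply i).snd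
  have hmD : ∀ N, Measurable fun z => Literature.MathematicalPhysics.KineticTheory.empiricalDensityField (N := N + 1) z χ := by
    intro N
    rw [show (fun z => Literature.MathematicalPhysics.KineticTheory.empiricalDensityField (N := N + 1) z χ) =
        fun z => ((N + 1 : ℕ) : ℝ)⁻¹ * ∑ i, χ (z i).1 from
      funext fun z => Literature.Analysis.FluidPDE.integral_empiricalMeasure z fun y => χ y.1]
    exact measurable_const.mul (Finset.measurable_sum _ fun i _ => hχ.measurable.comp (hpos i))
  have hmM : ∀ N, Measurable fun z => Literature.MathematicalPhysics.KineticTheory.empiricalMomentumField (N := N + 1) z χ := by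
    intro N
    have heq : (fun z => Literature.MathematicalPhysics.KineticTheory.empiricalMomentumField (N := N + 1) z χ) =
        fun z => (((N + 1 : ℕ) : ENNReal)⁻¹).toReal • ∑ i, χ (z i).1 • (z i).2 := by
      funext z
      show ∫ y, χ y.1 • y.2 ∂(Literature.Analysis.FluidPDE.empiricalMeasure z) = _
      rw [Literature.Analysis.FluidPDE.empiricalMeasure_eq, integral_smul_measure,
        integral_finsetSum_measure fun i _ => integrable_dirac enorm_lt_top]
      simp only [integral_dirac]
    rw [heq]
    exact (Finset.measurable_sum Finset.univ fun i _ =>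
      (hχ.measurable.comp (hpos i)).fun_smul (hvel i)).fun_const_smul _
  have hmE : ∀ N, Measurable fun z => Literature.MathematicalPhysics.KineticTheory.empiricalEnergyField (N := N + 1) z χ := by
    intro N
    rw [show (fun z => Literature.MathematicalPhysics.KineticTheory.empiricalEnergyField (N := N + 1) z χ) =
        fun z => ((N + 1 : ℕ) : ℝ)⁻¹ * ∑ i, χ (z i).1 * (‖(z i).2‖ ^ 2 / 2) from
      funext fun z => Literature.Analysis.FluidPDE.integral_empiricalMeasure z fun y => χ y.1 * (‖y.2‖ ^ 2 / 2)]
    exact measurable_const.mul (Finset.measurable_sum _ fun i _ =>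
      (hχ.measurable.comp (hpos i)).mul (((hvel i).norm.pow_const 2).div_const 2))
  -- `1`-Lipschitz maps do not increase distances; the elementary test functions
  have hdl : ∀ {α β : Type} [PseudoMetricSpace α] [PseudoMetricSpace β] (f : α → β),
      LipschitzWith 1 f → ∀ x y, dist (f x) (f y) ≤ dist x y :=
    fun f hf x y => by simpa using hf.dist_le_mul x y
  have habs : ∀ c : ℝ, LipschitzWith 1 fun x : ℝ => |x - c| :=
    fun c => by simpa only [Real.dist_eq] using LipschitzWith.dist_left c
  have hnrm : ∀ c : (EuclideanSpace ℝ (Fin 3)), LipschitzWith 1 fun x : (EuclideanSpace ℝ (Fin 3)) => ‖x - c‖ :=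
    fun c => by simpa only [dist_eq_norm] using LipschitzWith.dist_left c
  -- the three transfers (density, momentum, energy)
  refine ⟨?_, ?_, ?_⟩
  · exact key _ _ hfinP
      (fun N z => |Literature.MathematicalPhysics.KineticTheory.empiricalDensityField ((Φ N).flow t z) χ - ∫ x, χ x * ρ t x|) _
      (fun N => (((hmD N).comp ((Φ N).measurable_flow t)).sub measurable_const).abs)
      (fun g hg hg1 => hSw (fun y => g |y.1 - _|) (LipschitzWith.mk_one fun y y' =>
        (hdl g hg _ _).trans <| (hdl _ (habs _) _ _).trans (hdl _ LipschitzWith.prod_fst y y'))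
        fun y => hg1 _)
      (fun δ' hδ' => (hLa δ' hδ').1) δ hδ
  · exact key _ _ hfinP
      (fun N z => ‖Literature.MathematicalPhysics.KineticTheory.empiricalMomentumField ((Φ N).flow t z) χ - ∫ x, (χ x * ρ t x) • u t x‖) _
      (fun N => (((hmM N).comp ((Φ N).measurable_flow t)).sub measurable_const).norm)
      (fun g hg hg1 => hSw (fun y => g ‖y.2.1 - _‖) (LipschitzWith.mk_one fun y y' =>
        (hdl g hg _ _).trans <| (hdl _ (hnrm _) _ _).trans <|
          (hdl _ LipschitzWith.prod_fst y.2 y'.2).trans (hdl _ LipschitzWith.prod_snd y y'))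
        fun y => hg1 _)
      (fun δ' hδ' => (hLa δ' hδ').2.1) δ hδ
  · exact key _ _ hfinP (fun N z => |Literature.MathematicalPhysics.KineticTheory.empiricalEnergyField ((Φ N).flow t z) χ -
        ∫ x, χ x * Literature.MathematicalPhysics.KineticTheory.totalEnergyDensity (ρ t x) (u t x) (θ t x)|) _
      (fun N => (((hmE N).comp ((Φ N).measurable_flow t)).sub measurable_const).abs)
      (fun g hg hg1 => hSw (fun y => g |y.2.2 - _|) (LipschitzWith.mk_one fun y y' =>
        (hdl g hg _ _).trans <| (hdl _ (habs _) _ _).trans <|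
          (hdl _ LipschitzWith.prod_snd y.2 y'.2).trans (hdl _ LipschitzWith.prod_snd y y'))
        fun y => hg1 _)
      (fun δ' hδ' => (hLa δ' hδ').2.2) δ hδ

end Summit.AtomisticToContinuum.HydrodynamicLimit.Theses.LambertianContactSwap
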